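import Summits.Ventures.PercRepro.RankLevelSetHallExtension

/-!
# PercRepro — THE BOOLEAN UP WEIGHTS AT THE TIGHT LAYER: RECEIPT `Φ`, AND THE DEMAND SPENT ON THE LOST SUPERSETS
(p4, gen 40; paper proofs/P4-DEMAND.md §1; C-044 at the tight layer `#E = p + q`, any `k = p − q ≥ 2`)

A member `Z` pays the BOOLEAN UP WEIGHT `1 / C(#S, q)` to EVERY superset `S ⊇ Z` of size `q < #S < p` (`boolWeight`).  THIS FILE: every
member receives exactly `Φ(p, q) = Σ_{u=1}^{k−1} C(p, u)/C(q + u, q)` over the middle-size sets (`sum_boolWeight_eq_phiK`: the supersets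
`Z ∪ U`, `U ⊆ E ∖ Z`, `1 ≤ #U ≤ k − 1`, `C(p, u)` of them at each size; `phiK_eq_sum_choose_div` is the binomial identity
`C(p+q, q+u)·C(q+u, q) = C(p+q, p)·C(p, u)`), and the weight it spends on its LOST supersets (rank `q`, i.e. `Z ⊆ S ⊆ cl Z`,
`mem_lostUpSets_iff_subset_closure`) is its **demand** `δ(Z) = Σ_{a=1}^{k−1} C(d, a)/C(q + a, q)`, `d = #(cl Z ∖ Z)`
(`lostDemand`, `sum_boolWeight_lost_eq_lostDemand`).  The loads and the deficit inequality are in RankLevelSetHallBooleanDeficit.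

* `lostDemand`, `midSets`, `midSets_finite`, `boolWeight`, `boolWeight_nonneg`;
* `phiK_eq_sum_choose_div`, `sum_choose_ite_eq`, **`sum_boolWeight_eq_phiK`**;
* `mem_lostUpSets_iff_subset_closure`, **`sum_boolWeight_lost_eq_lostDemand`**.
Axioms: standard.
-/

namespace PercRepro

open Set Matroid Finset

variable {α : Type} (M : Matroid α) [M.Finite]

/-- **The demand of a member**: `δ(Z) = Σ_{a=1}^{k−1} C(d, a)/C(q + a, q)` with `d = #(cl Z ∖ Z)`, `k = p − q` — the Boolean UP weight
that `Z` spends on its lost supersets `Z ∪ A` (`A ⊆ cl Z ∖ Z`, `1 ≤ #A ≤ k − 1`).  (`C(q + a, q) = C(q + a, a)`.) -/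
noncomputable def lostDemand (p q : ℕ) (Z : Set α) : ℚ :=
  ∑ a ∈ Finset.Ioo 0 (p - q), (((M.closure Z \ Z).ncard.choose a : ℕ) : ℚ) / (((q + a).choose q : ℕ) : ℚ)

/-- The middle-size subsets of the ground set: `S ⊆ E` with `q < #S < p`. -/
def midSets (p q : ℕ) : Set (Set α) := {S | S ⊆ M.E ∧ q < S.ncard ∧ S.ncard < p}

/-- The middle-size sets form a finite family. -/
theorem midSets_finite (p q : ℕ) : (midSets M p q).Finite :=
  M.ground_finite.finite_subsets.subset (fun _ h => h.1)

omit [M.Finite] in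
/-- **The Boolean UP weight**: `1 / C(#S, q)` when `Z ⊆ S`, `0` otherwise. -/
noncomputable def boolWeight (q : ℕ) (Z S : Set α) : ℚ := by
  classical
  exact if Z ⊆ S then 1 / ((S.ncard.choose q : ℕ) : ℚ) else 0

omit [M.Finite] in
/-- The Boolean weight is non-negative. -/
theorem boolWeight_nonneg (q : ℕ) (Z S : Set α) : 0 ≤ boolWeight q Z S := by
  unfold boolWeight
  split_ifs
  · positivity
  · exact le_rfl

/-- **`Φ(p, q)` as a sum over the sizes of the supersets**: `Φ(p, q) = Σ_{u=1}^{k−1} C(p, u)/C(q + u, q)` (`Nat.choose_mul`: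
`C(p+q, q+u)·C(q+u, q) = C(p+q, q)·C(p, u)`, and `C(p+q, q) = C(p+q, p)`). -/
theorem phiK_eq_sum_choose_div (p q : ℕ) (hqp : q ≤ p) :
    phiK p q = ∑ u ∈ Finset.Ioo 0 (p - q), ((p.choose u : ℕ) : ℚ) / (((q + u).choose q : ℕ) : ℚ) := by
  unfold phiK
  rw [Finset.sum_div]
  have himg : Finset.Ioo q p = (Finset.Ioo 0 (p - q)).image (fun u => q + u) := by
    rw [Finset.image_add_left_Ioo, add_zero, Nat.add_sub_cancel' hqp]
  rw [himg, Finset.sum_image (fun a _ b _ h => by omega)]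
  apply Finset.sum_congr rfl
  intro u _
  have hpos1 : (0 : ℚ) < (((p + q).choose p : ℕ) : ℚ) := by
    exact_mod_cast Nat.choose_pos (by omega)
  have hpos2 : (0 : ℚ) < (((q + u).choose q : ℕ) : ℚ) := by
    exact_mod_cast Nat.choose_pos (by omega)
  have hmul : (p + q).choose (q + u) * (q + u).choose q = p.choose u * (p + q).choose p := by
    have h := Nat.choose_mul (n := p + q) (k := q + u) (s := q) (by omega)
    rw [h, Nat.add_sub_cancel, Nat.add_sub_cancel_left, Nat.choose_symm_add, mul_comm]
  rw [div_eq_div_iff hpos1.ne' hpos2.ne']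
  exact_mod_cast hmul

/-- Replacing `Σ_{a ≤ d} C(d, a)·(if 0 < a < k then f a else 0)` by `Σ_{0 < a < k} C(d, a)·f a` (the terms with `a > d` vanish). -/
theorem sum_choose_ite_eq (d k : ℕ) (f : ℕ → ℚ) :
    ∑ a ∈ Finset.range (d + 1), ((d.choose a : ℕ) : ℚ) * (if 0 < a ∧ a < k then f a else 0)
      = ∑ a ∈ Finset.Ioo 0 k, ((d.choose a : ℕ) : ℚ) * f a := by
  classical
  have h1 : ∑ a ∈ Finset.range (d + 1), ((d.choose a : ℕ) : ℚ) * (if 0 < a ∧ a < k then f a else 0)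
      = ∑ a ∈ Finset.range (d + k + 1), ((d.choose a : ℕ) : ℚ) * (if 0 < a ∧ a < k then f a else 0) := by
    apply Finset.sum_subset
    · intro a ha
      rw [Finset.mem_range] at ha ⊢
      omega
    · intro a _ ha
      rw [Finset.mem_range, not_lt] at ha
      rw [Nat.choose_eq_zero_of_lt (by omega)]
      simp
  have h2 : ∑ a ∈ Finset.range (d + k + 1), ((d.choose a : ℕ) : ℚ) * (if 0 < a ∧ a < k then f a else 0)
      = ∑ a ∈ Finset.Ioo 0 k, ((d.choose a : ℕ) : ℚ) * f a := by
    simp only [mul_ite, mul_zero]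
    rw [← Finset.sum_filter]
    apply Finset.sum_congr
    · ext a
      rw [Finset.mem_filter, Finset.mem_Ioo, Finset.mem_range]
      omega
    · intro a _
      rfl
  rw [h1, h2]

/-- **Every member receives exactly `Φ(p, q)`** from the Boolean UP weights over the middle-size sets: the supersets
`Z ∪ U` (`U ⊆ E ∖ Z`, `1 ≤ #U ≤ k − 1`) are exactly the middle-size supersets of `Z`, `C(p, u)` of them at each size `q + u`. -/
theorem sum_boolWeight_eq_phiK (p q : ℕ) (hp : q + 2 ≤ p) (hE : M.E.ncard = p + q) {Z : Set α}
    (hZ : Z ∈ cellMembers M p q) :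
    ∑ S ∈ (midSets_finite M p q).toFinset, boolWeight q Z S = phiK p q := by
  classical
  have hZE : Z ⊆ M.E := hZ.1
  have hZq : Z.ncard = q := ncard_eq_q_of_mem_cellMembers_tight M hE hZ
  have hEfin : M.E.Finite := M.set_finite M.E
  have hZfin : Z.Finite := hEfin.subset hZE
  set B : Set α := M.E \ Z with hB
  have hBfin : B.Finite := hEfin.subset sdiff_subset
  have hBcard : B.ncard = p := (compl_indep_of_mem_U M hE hZ).2
  set Bf : Finset α := hBfin.toFinset with hBf
  have hBfcard : Bf.card = p := by rw [hBf, ← ncard_eq_toFinset_card _ hBfin, hBcard]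
  have hmemBf : ∀ x, x ∈ Bf ↔ x ∈ M.E ∧ x ∉ Z := fun x => by
    rw [hBf, Set.Finite.mem_toFinset, hB, Set.mem_sdiff]
  set Pf : Finset (Set α) := (midSets_finite M p q).toFinset with hPf
  have hmemPf : ∀ S, S ∈ Pf ↔ S ⊆ M.E ∧ q < S.ncard ∧ S.ncard < p := fun S => by
    rw [hPf, Set.Finite.mem_toFinset]
    rfl
  let g : Finset α → Set α := fun U => Z ∪ (U : Set α)
  -- the size of Z ∪ U for U ⊆ Bf
  have hgcard : ∀ U ∈ Bf.powerset, (g U).ncard = q + U.card := by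
    intro U hU
    rw [Finset.mem_powerset] at hU
    have hdisj : Disjoint Z (U : Set α) := by
      rw [Set.disjoint_left]
      intro x hxZ hxU
      exact ((hmemBf x).1 (hU (Finset.mem_coe.1 hxU))).2 hxZ
    show (Z ∪ (U : Set α)).ncard = q + U.card
    rw [Set.ncard_union_eq hdisj hZfin (Finset.finite_toSet _), hZq, ncard_coe_finset]
  -- g is injective on the powerset
  have hinj : Set.InjOn g (Bf.powerset : Set (Finset α)) := by
    intro U hU U' hU' heq
    rw [Finset.mem_coe, Finset.mem_powerset] at hU hU'
    have hdiff : ∀ (V : Finset α), V ⊆ Bf → (Z ∪ (V : Set α)) \ Z = (V : Set α) := by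
      intro V hV
      ext x
      simp only [Set.mem_sdiff, Set.mem_union]
      constructor
      · rintro ⟨h | h, hx⟩
        · exact absurd h hx
        · exact h
      · intro h
        exact ⟨Or.inr h, ((hmemBf x).1 (hV (Finset.mem_coe.1 h))).2⟩
    have : (U : Set α) = (U' : Set α) := by
      rw [← hdiff U hU, ← hdiff U' hU']
      show g U \ Z = g U' \ Z
      rw [heq]
    exact Finset.coe_injective this
  -- the middle supersets of Z are the images of the U with 1 ≤ #U ≤ k − 1
  have hfilt : Pf.filter (fun S => Z ⊆ S)
      = (Bf.powerset.filter (fun U => 0 < U.card ∧ U.card < p - q)).image g := by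
    ext S
    rw [Finset.mem_filter, hmemPf, Finset.mem_image]
    constructor
    · rintro ⟨⟨hSE, hq, hp'⟩, hZS⟩
      have hSfin : S.Finite := hEfin.subset hSE
      refine ⟨(hSfin.subset (sdiff_subset : S \ Z ⊆ S)).toFinset, ?_, ?_⟩
      · rw [Finset.mem_filter, Finset.mem_powerset]
        have hcard : (hSfin.subset (sdiff_subset : S \ Z ⊆ S)).toFinset.card = (S \ Z).ncard := by
          rw [← ncard_eq_toFinset_card _ (hSfin.subset (sdiff_subset : S \ Z ⊆ S))]
        have hSZ : (S \ Z).ncard + Z.ncard = S.ncard := ncard_sdiff_add_ncard_of_subset hZS hSfin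
        refine ⟨?_, ?_, ?_⟩
        · intro x hx
          rw [Set.Finite.mem_toFinset, Set.mem_sdiff] at hx
          rw [hmemBf]
          exact ⟨hSE hx.1, hx.2⟩
        · rw [hcard]; omega
        · rw [hcard]; omega
      · show Z ∪ ((hSfin.subset (sdiff_subset : S \ Z ⊆ S)).toFinset : Set α) = S
        rw [Set.Finite.coe_toFinset, Set.union_sdiff_cancel hZS]
    · rintro ⟨U, hU, rfl⟩
      rw [Finset.mem_filter, Finset.mem_powerset] at hU
      obtain ⟨hUB, hU1, hUk⟩ := hU
      have hc := hgcard U (Finset.mem_powerset.2 hUB)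
      refine ⟨⟨?_, ?_, ?_⟩, Set.subset_union_left⟩
      · show Z ∪ (U : Set α) ⊆ M.E
        refine Set.union_subset hZE (fun x hx => ((hmemBf x).1 (hUB (Finset.mem_coe.1 hx))).1)
      · rw [hc]; omega
      · rw [hc]; omega
  -- evaluate the sum
  have hsum : ∑ S ∈ Pf, boolWeight q Z S
      = ∑ U ∈ Bf.powerset, (if 0 < U.card ∧ U.card < p - q then 1 / (((q + U.card).choose q : ℕ) : ℚ) else 0) := by
    have h1 : ∑ S ∈ Pf, boolWeight q Z S = ∑ S ∈ Pf.filter (fun S => Z ⊆ S), 1 / ((S.ncard.choose q : ℕ) : ℚ) := by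
      rw [Finset.sum_filter]
      apply Finset.sum_congr rfl
      intro S _
      unfold boolWeight
      rfl
    rw [h1, hfilt, Finset.sum_image (hinj.mono (fun U hU => Finset.mem_coe.2 (Finset.mem_filter.1 (Finset.mem_coe.1 hU)).1)),
      Finset.sum_filter]
    apply Finset.sum_congr rfl
    intro U hU
    split_ifs with h
    · rw [hgcard U hU]
    · rfl
  rw [hsum, Finset.sum_powerset_apply_card (fun m => (if 0 < m ∧ m < p - q then 1 / (((q + m).choose q : ℕ) : ℚ) else 0)),
    hBfcard]
  simp only [nsmul_eq_mul]
  rw [sum_choose_ite_eq p (p - q) (fun m => 1 / (((q + m).choose q : ℕ) : ℚ)), phiK_eq_sum_choose_div p q (by omega)]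
  apply Finset.sum_congr rfl
  intro u _
  rw [mul_one_div]

/-- For a member `Z`, a set is a lost set of `𝒜 ∋ Z` containing `Z` iff it lies between `Z` and `cl Z` with size in `(q, p)`. -/
theorem mem_lostUpSets_iff_subset_closure (p q : ℕ) {𝒜 : Set (Set α)} {Z S : Set α}
    (hZ : Z ∈ cellMembers M p q) (hZ𝒜 : Z ∈ 𝒜) :
    (S ∈ lostUpSets M p q 𝒜 ∧ Z ⊆ S) ↔ (Z ⊆ S ∧ S ⊆ M.closure Z ∧ q < S.ncard ∧ S.ncard < p) := by
  have hZE : Z ⊆ M.E := hZ.1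
  have hZfin : Z.Finite := (M.set_finite M.E).subset hZE
  constructor
  · rintro ⟨⟨hSE, hq, hp', hrk, -⟩, hZS⟩
    refine ⟨hZS, ?_, hq, hp'⟩
    have hrk' : M.eRk S ≤ M.eRk Z := by rw [hrk, hZ.2.1]
    have hcl := (M.isRkFinite_of_finite hZfin).closure_eq_closure_of_subset_of_eRk_ge_eRk hZS hrk'
    rw [hcl]
    exact M.subset_closure S hSE
  · rintro ⟨hZS, hScl, hq, hp'⟩
    have hSE : S ⊆ M.E := hScl.trans (M.closure_subset_ground Z)
    refine ⟨⟨hSE, hq, hp', ?_, Z, hZ𝒜, hZS⟩, hZS⟩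
    apply le_antisymm
    · calc M.eRk S ≤ M.eRk (M.closure Z) := M.eRk_mono hScl
        _ = (q : ℕ∞) := by rw [M.eRk_closure_eq, hZ.2.1]
    · rw [← hZ.2.1]
      exact M.eRk_mono hZS

/-- **The weight a member spends on its lost supersets is its demand**: the lost supersets of `Z` are the sets `Z ∪ A`
(`A ⊆ cl Z ∖ Z`, `1 ≤ #A ≤ k − 1`), `C(d, a)` of them at each size `q + a`. -/
theorem sum_boolWeight_lost_eq_lostDemand (p q : ℕ) (hE : M.E.ncard = p + q) {𝒜 : Set (Set α)} {Z : Set α}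
    (hZ : Z ∈ cellMembers M p q) (hZ𝒜 : Z ∈ 𝒜) :
    ∑ S ∈ (lostUpSets_finite M p q 𝒜).toFinset, boolWeight q Z S = lostDemand M p q Z := by
  classical
  have hZE : Z ⊆ M.E := hZ.1
  have hZq : Z.ncard = q := ncard_eq_q_of_mem_cellMembers_tight M hE hZ
  have hEfin : M.E.Finite := M.set_finite M.E
  have hZfin : Z.Finite := hEfin.subset hZE
  set D : Set α := M.closure Z \ Z with hD
  have hDfin : D.Finite := (hEfin.subset (M.closure_subset_ground Z)).subset sdiff_subset
  set Df : Finset α := hDfin.toFinset with hDf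
  have hDfcard : Df.card = D.ncard := by rw [hDf, ← ncard_eq_toFinset_card _ hDfin]
  have hmemDf : ∀ x, x ∈ Df ↔ x ∈ M.closure Z ∧ x ∉ Z := fun x => by
    rw [hDf, Set.Finite.mem_toFinset, hD, Set.mem_sdiff]
  set Lf : Finset (Set α) := (lostUpSets_finite M p q 𝒜).toFinset with hLf
  have hmemLf : ∀ S, S ∈ Lf ↔ S ∈ lostUpSets M p q 𝒜 := fun S => by
    rw [hLf, Set.Finite.mem_toFinset]
  let g : Finset α → Set α := fun A => Z ∪ (A : Set α)
  have hgcard : ∀ A ∈ Df.powerset, (g A).ncard = q + A.card := by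
    intro A hA
    rw [Finset.mem_powerset] at hA
    have hdisj : Disjoint Z (A : Set α) := by
      rw [Set.disjoint_left]
      intro x hxZ hxA
      exact ((hmemDf x).1 (hA (Finset.mem_coe.1 hxA))).2 hxZ
    show (Z ∪ (A : Set α)).ncard = q + A.card
    rw [Set.ncard_union_eq hdisj hZfin (Finset.finite_toSet _), hZq, ncard_coe_finset]
  have hinj : Set.InjOn g (Df.powerset : Set (Finset α)) := by
    intro A hA A' hA' heq
    rw [Finset.mem_coe, Finset.mem_powerset] at hA hA'
    have hdiff : ∀ (V : Finset α), V ⊆ Df → (Z ∪ (V : Set α)) \ Z = (V : Set α) := by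
      intro V hV
      ext x
      simp only [Set.mem_sdiff, Set.mem_union]
      constructor
      · rintro ⟨h | h, hx⟩
        · exact absurd h hx
        · exact h
      · intro h
        exact ⟨Or.inr h, ((hmemDf x).1 (hV (Finset.mem_coe.1 h))).2⟩
    have : (A : Set α) = (A' : Set α) := by
      rw [← hdiff A hA, ← hdiff A' hA']
      show g A \ Z = g A' \ Z
      rw [heq]
    exact Finset.coe_injective this
  have hfilt : Lf.filter (fun S => Z ⊆ S)
      = (Df.powerset.filter (fun A => 0 < A.card ∧ A.card < p - q)).image g := by
    ext S
    rw [Finset.mem_filter, hmemLf, mem_lostUpSets_iff_subset_closure M p q hZ hZ𝒜, Finset.mem_image]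
    constructor
    · rintro ⟨hZS, hScl, hq, hp'⟩
      have hSfin : S.Finite := hEfin.subset (hScl.trans (M.closure_subset_ground Z))
      refine ⟨(hSfin.subset (sdiff_subset : S \ Z ⊆ S)).toFinset, ?_, ?_⟩
      · rw [Finset.mem_filter, Finset.mem_powerset]
        have hcard : (hSfin.subset (sdiff_subset : S \ Z ⊆ S)).toFinset.card = (S \ Z).ncard := by
          rw [← ncard_eq_toFinset_card _ (hSfin.subset (sdiff_subset : S \ Z ⊆ S))]
        have hSZ : (S \ Z).ncard + Z.ncard = S.ncard := ncard_sdiff_add_ncard_of_subset hZS hSfin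
        refine ⟨?_, ?_, ?_⟩
        · intro x hx
          rw [Set.Finite.mem_toFinset, Set.mem_sdiff] at hx
          rw [hmemDf]
          exact ⟨hScl hx.1, hx.2⟩
        · rw [hcard]; omega
        · rw [hcard]; omega
      · show Z ∪ ((hSfin.subset (sdiff_subset : S \ Z ⊆ S)).toFinset : Set α) = S
        rw [Set.Finite.coe_toFinset, Set.union_sdiff_cancel hZS]
    · rintro ⟨A, hA, rfl⟩
      rw [Finset.mem_filter, Finset.mem_powerset] at hA
      obtain ⟨hAD, hA1, hAk⟩ := hA
      have hc := hgcard A (Finset.mem_powerset.2 hAD)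
      refine ⟨Set.subset_union_left, ?_, ?_, ?_⟩
      · show Z ∪ (A : Set α) ⊆ M.closure Z
        exact Set.union_subset (M.subset_closure Z hZE)
          (fun x hx => ((hmemDf x).1 (hAD (Finset.mem_coe.1 hx))).1)
      · rw [hc]; omega
      · rw [hc]; omega
  have hsum : ∑ S ∈ Lf, boolWeight q Z S
      = ∑ A ∈ Df.powerset, (if 0 < A.card ∧ A.card < p - q then 1 / (((q + A.card).choose q : ℕ) : ℚ) else 0) := by
    have h1 : ∑ S ∈ Lf, boolWeight q Z S = ∑ S ∈ Lf.filter (fun S => Z ⊆ S), 1 / ((S.ncard.choose q : ℕ) : ℚ) := by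
      rw [Finset.sum_filter]
      apply Finset.sum_congr rfl
      intro S _
      unfold boolWeight
      rfl
    rw [h1, hfilt, Finset.sum_image (hinj.mono (fun A hA => Finset.mem_coe.2 (Finset.mem_filter.1 (Finset.mem_coe.1 hA)).1)),
      Finset.sum_filter]
    apply Finset.sum_congr rfl
    intro A hA
    split_ifs with h
    · rw [hgcard A hA]
    · rfl
  rw [hsum, Finset.sum_powerset_apply_card (fun m => (if 0 < m ∧ m < p - q then 1 / (((q + m).choose q : ℕ) : ℚ) else 0)),
    hDfcard]
  simp only [nsmul_eq_mul]
  rw [sum_choose_ite_eq D.ncard (p - q) (fun m => 1 / (((q + m).choose q : ℕ) : ℚ))]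
  unfold lostDemand
  apply Finset.sum_congr rfl
  intro a _
  rw [mul_one_div]

end PercRepro
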